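import Summits.NavierStokesRegularity.NavierStokesRegularity.Theses.AxisymmetricExtremality
import Literature.Analysis.FluidPDE.LeiZhang2017AxisymmetricCriteria
import Literature.Analysis.FluidPDE.Wei2016AprioriHolds
import Literature.Analysis.FluidPDE.SelfSimilar
import HarnessLib

/-!
# Strategist census s12-g9 (INDEPENDENT family `-s`) — typed attempts for crux
`AxisymmetricExtremality.AxisymmetricKatoGlobal` (stmt-NavierStokesRegularity-15453)

Scratch sketch of planner-cstrat-stmt-NavierStokesRegularity-15453-s12-g9-0. Definitions and
pure-logic seams only (no `sorry`): the statements the census `STRATEGY-CENSUS-s12-g9.md` refers to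
under `## Weaker intermediate`, `## Decomposition`, `## Transfer`, `## Strengthen`, `## Negation`.
Nothing here is a route item or a registered stub.
-/

noncomputable section

open MeasureTheory Set Function Filter
open scoped ENNReal

namespace Summit.NavierStokesRegularity.NavierStokesRegularity.Cruxes.AxisymmetricKatoGlobal.StrategistS12g9

open Literature.Analysis.FluidPDE
open Summit.NavierStokesRegularity.NavierStokesRegularity.Theses.AxisymmetricExtremality

-- the problem directory repeats the summit name
set_option linter.dupNamespace false

local notation "ℝ³" => EuclideanSpace ℝ (Fin 3)
local notation "ℂ³" => EuclideanSpace ℂ (Fin 3)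

/-! ## Frame: the route's inline axisymmetry clause -/

/-- The rotation-equivariance clause written inline in the route file (= `IsAxisymmetric u₀`). -/
def AxisymClause (u₀ : ℝ³ → ℝ³) : Prop :=
  ∀ (θ : ℝ) (x : ℝ³),
    u₀ (WithLp.toLp 2 ![Real.cos θ * x 0 - Real.sin θ * x 1, Real.sin θ * x 0 + Real.cos θ * x 1, x 2]) =
      WithLp.toLp 2 ![Real.cos θ * u₀ x 0 - Real.sin θ * u₀ x 1, Real.sin θ * u₀ x 0 + Real.cos θ * u₀ x 1, u₀ x 2]

theorem axisymClause_iff_isAxisymmetric (u₀ : ℝ³ → ℝ³) : AxisymClause u₀ ↔ IsAxisymmetric u₀ :=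
  Iff.rfl

/-- The crux, restated with the clause abbreviated (definitionally the route decl). -/
theorem crux_iff :
    AxisymmetricKatoGlobal ↔
      ∀ ν : ℝ, 0 < ν → ∀ (u₀ : ℝ³ → ℝ³)
        (g : Literature.Analysis.FunctionSpaces.HomSobolev ℝ³ ℂ³ (1 / 2 : ℝ)),
        MemLp u₀ 3 volume → g.Represents (Literature.Analysis.FunctionSpaces.EuclideanSpace.complexify ∘ u₀) →
        IsWeaklyDivFree u₀ → AxisymClause u₀ → HasGlobalKatoSolution ν u₀ :=
  Iff.rfl

/-! ## (1) Weaker intermediate replacing the crux in `closes`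

`closes` consumes `AxisymmetricKatoGlobal` only at an axisymmetric Rusin–Šverák MINIMAL blow-up
datum. The weakest statement that can replace it verbatim is `NoAxisymMinimalBlowupDatum` (W₀). -/

/-- **W₀**: no Rusin–Šverák `Ḣ^{1/2}`-minimal blow-up datum is axisymmetric. -/
def NoAxisymMinimalBlowupDatum : Prop :=
  ∀ ν : ℝ, 0 < ν → ∀ (u₀ : ℝ³ → ℝ³)
    (g : Literature.Analysis.FunctionSpaces.HomSobolev ℝ³ ℂ³ (1 / 2 : ℝ)),
    IsMinimalBlowupDatum ν u₀ g → AxisymClause u₀ → False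

/-- W₀ is formally weaker than the crux. -/
theorem noAxisymMinimalBlowupDatum_of_crux (h : AxisymmetricKatoGlobal) : NoAxisymMinimalBlowupDatum := by
  intro ν hν u₀ g hmin hax
  obtain ⟨hL3, hrep, hdiv, -, hnot⟩ := hmin
  exact hnot (h ν hν u₀ g hL3 hrep hdiv hax)

/-- W₀ can replace the crux in the route's deciding theorem verbatim (same proof as `closes`). -/
theorem closes_of_noAxisymMinimalBlowupDatum (h₂ : MinimalDatumPFold) (h₄ : PFoldToAxisymmetric)
    (hW : NoAxisymMinimalBlowupDatum) : NavierStokesRegularity := by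
  show Literature.NS.NavierStokesExistenceSmoothR3
  intro ν hν u₀ hsm hdiv hdec
  by_contra hno
  obtain ⟨u₁, g, hmin, hax⟩ := h₄ ν hν (h₂ ν hν ⟨u₀, hsm, hdiv, hdec, hno⟩)
  exact hW ν hν u₁ g hmin hax

/-- W₀ unfolded: the crux restricted to the THRESHOLD SPHERE `‖g‖_{Ḣ^{1/2}} = ρ_max^pure(ν)`. -/
def AxisymKatoGlobalOnThresholdSphere : Prop :=
  ∀ ν : ℝ, 0 < ν → ∀ (u₀ : ℝ³ → ℝ³)
    (g : Literature.Analysis.FunctionSpaces.HomSobolev ℝ³ ℂ³ (1 / 2 : ℝ)),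
    MemLp u₀ 3 volume → g.Represents (Literature.Analysis.FunctionSpaces.EuclideanSpace.complexify ∘ u₀) →
    IsWeaklyDivFree u₀ → AxisymClause u₀ → ‖g‖ₑ = rusinSverakRhoMaxPure ν → HasGlobalKatoSolution ν u₀

theorem noAxisymMinimalBlowupDatum_iff_sphere :
    NoAxisymMinimalBlowupDatum ↔ AxisymKatoGlobalOnThresholdSphere := by
  constructor
  · intro h ν hν u₀ g h3 hrep hdiv hax hnorm
    by_contra hno
    exact h ν hν u₀ g ⟨h3, hrep, hdiv, hnorm, hno⟩ hax
  · intro h ν hν u₀ g hmin hax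
    obtain ⟨h3, hrep, hdiv, hnorm, hno⟩ := hmin
    exact hno (h ν hν u₀ g h3 hrep hdiv hax hnorm)

/-- The crux UP TO AND INCLUDING the threshold (strictly below it is the unfolding of `ρ_max^pure`,
`hasGlobalKatoSolution_of_lt_rusinSverakRhoMaxPure`): equivalent to W₀. -/
def AxisymKatoGlobalUpToThreshold : Prop :=
  ∀ ν : ℝ, 0 < ν → ∀ (u₀ : ℝ³ → ℝ³)
    (g : Literature.Analysis.FunctionSpaces.HomSobolev ℝ³ ℂ³ (1 / 2 : ℝ)),
    MemLp u₀ 3 volume → g.Represents (Literature.Analysis.FunctionSpaces.EuclideanSpace.complexify ∘ u₀) →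
    IsWeaklyDivFree u₀ → AxisymClause u₀ → ‖g‖ₑ ≤ rusinSverakRhoMaxPure ν → HasGlobalKatoSolution ν u₀

theorem upToThreshold_iff_sphere : AxisymKatoGlobalUpToThreshold ↔ AxisymKatoGlobalOnThresholdSphere := by
  constructor
  · intro h ν hν u₀ g h3 hrep hdiv hax hnorm
    exact h ν hν u₀ g h3 hrep hdiv hax hnorm.le
  · intro h ν hν u₀ g h3 hrep hdiv hax hle
    rcases hle.lt_or_eq with hlt | heq
    · exact hasGlobalKatoSolution_of_lt_rusinSverakRhoMaxPure h3 hrep hdiv hlt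
    · exact h ν hν u₀ g h3 hrep hdiv hax heq

/-- **Strict axisymmetric threshold gap** ("ρ_ax(ν) > ρ_max(ν)"): the only visible mechanism for W₀
short of the full crux. It implies W₀ (below). -/
def AxisymThresholdGap : Prop :=
  ∀ ν : ℝ, 0 < ν → rusinSverakRhoMaxPure ν < ⊤ →
    ∃ ρ : ℝ≥0∞, rusinSverakRhoMaxPure ν < ρ ∧ ∀ (u₀ : ℝ³ → ℝ³)
      (g : Literature.Analysis.FunctionSpaces.HomSobolev ℝ³ ℂ³ (1 / 2 : ℝ)),
      MemLp u₀ 3 volume → g.Represents (Literature.Analysis.FunctionSpaces.EuclideanSpace.complexify ∘ u₀) →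
      IsWeaklyDivFree u₀ → AxisymClause u₀ → ‖g‖ₑ < ρ → HasGlobalKatoSolution ν u₀

theorem sphere_of_gap (h : AxisymThresholdGap) : AxisymKatoGlobalOnThresholdSphere := by
  intro ν hν u₀ g h3 hrep hdiv hax hnorm
  by_cases htop : rusinSverakRhoMaxPure ν = ⊤
  · exact absurd (hnorm.trans htop) enorm_ne_top
  · obtain ⟨ρ, hρ, hall⟩ := h ν hν (lt_top_iff_ne_top.2 htop)
    exact hall u₀ g h3 hrep hdiv hax (hnorm ▸ hρ)

/-! ## (2) Decomposition — typed splits (the piece that stays the crux is named in the census)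

D-small: the crux on data with swirl `Γ₀ = r u_θ` essentially bounded by `κ ν` (scale invariant). -/

/-- Small-swirl piece at level `κ`: the crux for data with `|Γ₀| ≤ κ ν` a.e. -/
def SmallSwirlPiece (κ : ℝ) : Prop :=
  ∀ ν : ℝ, 0 < ν → ∀ (u₀ : ℝ³ → ℝ³)
    (g : Literature.Analysis.FunctionSpaces.HomSobolev ℝ³ ℂ³ (1 / 2 : ℝ)),
    MemLp u₀ 3 volume → g.Represents (Literature.Analysis.FunctionSpaces.EuclideanSpace.complexify ∘ u₀) →
    IsWeaklyDivFree u₀ → AxisymClause u₀ → (∀ᵐ x ∂(volume : Measure ℝ³), |swirl u₀ x| ≤ κ * ν) →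
    HasGlobalKatoSolution ν u₀

/-- Bounded-swirl piece: the crux for data with `Γ₀ ∈ L^∞` (Ladyzhenskaya's class) — the union of
the small-swirl pieces over all levels. -/
def BoundedSwirlPiece : Prop := ∀ κ : ℝ, SmallSwirlPiece κ

theorem smallSwirlPiece_of_crux (h : AxisymmetricKatoGlobal) (κ : ℝ) : SmallSwirlPiece κ :=
  fun ν hν u₀ g h3 hrep hdiv hax _ => h ν hν u₀ g h3 hrep hdiv hax

/-- D-modulus (Clay class, `ν = 1`): the A-PRIORI Wei axis modulus for classical Leray–Hopf
axisymmetric solutions from rapidly decaying data — the open half of the split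
"modulus ∧ (modulus ⇒ regular)"; the second half is the PROVED tree fact
`Wei2016_logModulus_regularity_holds`. -/
def AprioriWeiAxisModulus : Prop :=
  ∀ (T : ℝ) (u : ℝ → ℝ³ → ℝ³) (p : ℝ → ℝ³ → ℝ), 0 < T →
    IsClassicalNSSolutionOn (Ico 0 T) 1 0 u p → IsLerayHopfOn T 1 0 (u 0) u →
    HasRapidSpatialDecay (u 0) → (∀ t ∈ Ico 0 T, IsAxisymmetric (u t)) →
    ∃ δ₀ : ℝ, 0 < δ₀ ∧ δ₀ < 1 / 2 ∧
      ∀ t ∈ Ico 0 T, ∀ x : ℝ³, 0 < cylRadius x → cylRadius x ≤ δ₀ →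
        |swirl (u t) x| ≤ |Real.log (cylRadius x)| ^ (-(3 / 2 : ℝ))

/-- Kernel-checked seam of the D-modulus split: a-priori modulus + Wei's PROVED criterion ⇒ no
finite-time blow-up in the classical axisymmetric class (`ν = 1`). -/
theorem hasSmoothExtensionPast_of_aprioriWeiAxisModulus (hA : AprioriWeiAxisModulus)
    (T : ℝ) (u : ℝ → ℝ³ → ℝ³) (p : ℝ → ℝ³ → ℝ) (hT : 0 < T)
    (hcl : IsClassicalNSSolutionOn (Ico 0 T) 1 0 u p) (hLH : IsLerayHopfOn T 1 0 (u 0) u)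
    (hdec : HasRapidSpatialDecay (u 0)) (hax : ∀ t ∈ Ico 0 T, IsAxisymmetric (u t)) :
    HasSmoothExtensionPast 1 0 u T := by
  obtain ⟨δ₀, hδ₀, hδ, hmod⟩ := hA T u p hT hcl hLH hdec hax
  exact Wei2016_logModulus_regularity_holds δ₀ hδ₀ hδ T u p hT hcl hLH hdec hax
    hdec.eLpNorm_swirl_lt_top hmod

/-! ## (3) Transfer / Strengthen — the KNSS Liouville conjecture, typed -/

/-- **KNSS Liouville conjecture, axisymmetric class** (Koch–Nadirashvili–Seregin–Šverák 2009, §1;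
Zhang's review arXiv:2101.04905 p.10): a bounded ancient mild solution (`ν = 1`) with measurable,
axisymmetric slices is a constant (then necessarily `c e₃`). OPEN; typed here only to record that it
does NOT feed the crux (Type II blow-up limits may be non-zero constants). -/
def KNSSLiouvilleConjectureAxisym : Prop :=
  ∀ (u : ℝ → ℝ³ → ℝ³), IsAncientMildSolution 1 u → (∀ t < 0, AEStronglyMeasurable (u t) volume) →
    (∃ C : ℝ, ∀ t < 0, ∀ x, ‖u t x‖ ≤ C) → (∀ t < 0, IsAxisymmetric (u t)) →
    ∃ c : ℝ³, ∀ t < 0, u t =ᵐ[volume] fun _ => c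

/-! ## (4) Negation — the object a counterexample must be -/

theorem not_crux_iff :
    ¬ AxisymmetricKatoGlobal ↔
      ∃ ν : ℝ, 0 < ν ∧ ∃ (u₀ : ℝ³ → ℝ³)
        (g : Literature.Analysis.FunctionSpaces.HomSobolev ℝ³ ℂ³ (1 / 2 : ℝ)),
        MemLp u₀ 3 volume ∧ g.Represents (Literature.Analysis.FunctionSpaces.EuclideanSpace.complexify ∘ u₀) ∧
        IsWeaklyDivFree u₀ ∧ AxisymClause u₀ ∧ ¬ HasGlobalKatoSolution ν u₀ := by
  rw [crux_iff]
  push Not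
  rfl

end Summit.NavierStokesRegularity.NavierStokesRegularity.Cruxes.AxisymmetricKatoGlobal.StrategistS12g9

end
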